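import Summits.AtomisticToContinuum.BoseEinsteinCondensation.Theorems.BECConjugateDominationHardCoreExtensionNearMinTower
import Summits.AtomisticToContinuum.BoseEinsteinCondensation.Theorems.PeriodicIRBound.Negative.AEClass
import HarnessLib

/-!
# Near-minimiser truncation-tower BEC sees only the a.e.-class of the potential
# (crux `BECConjugateDomination.HardCoreExtension`, stmt-AtomisticToContinuum-11786 — line `near-minimiser-slack-transfer`, lead c7)

Sequel of `…HardCoreExtensionNearMinTower.lean`. The registered thermodynamic stub T★(v) of the line (near-minimiser periodic BEC
along the truncation tower `min(v,n)`, slack level-uniform) depends only on the a.e.-class of the radial potential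
`x ↦ v(|x|)` on `ℝ³` (`nearMinimiserTowerBEC_congr_ae`; truncation commutes with a.e.-equality and the periodic quadratic forms
see only the a.e.-class, `periodicEnergy_congr_ae`), exactly like near-minimiser periodic BEC itself (`periodicBEC_congr_ae`).
Hence T★ asks nothing new of every ESSENTIALLY bounded admissible potential: `nearMinimiserTowerBEC_iff_periodicBEC_of_ae_bounded`
(unconditional; the general equivalence for unbounded `v` goes through the compactness / maximal-form-density argument of
`…HardCoreExtensionNearMinTowerNecessity.lean`). The level-uniformity demanded by T★ is a genuine extra feature only for
essentially unbounded potentials — hard cores and non-`L∞` singularities — the class the crux exists for.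

References: E. H. Lieb, R. Seiringer, J. P. Solovej, J. Yngvason, *The Mathematics of the Bose Gas and its Condensation*
(2005), §1.2 (1.19), Ch. 5 p. 42.
-/

noncomputable section

namespace Summit.AtomisticToContinuum.BoseEinsteinCondensation.Cruxes.HardCoreExtension.NearMinTower

open MeasureTheory Filter
open scoped ENNReal NNReal Topology
open Literature.MathematicalPhysics.QuantumManyBody.BoseGas
open Summit.AtomisticToContinuum.BoseEinsteinCondensation.Theorems.PeriodicIRBound.Negative

/-- Truncation commutes with a.e.-equality of radial potentials. [folklore] -/
theorem ae_min_congr {v v' : ℝ → ℝ≥0∞} (h : ∀ᵐ x : Space, v ‖x‖ = v' ‖x‖) (n : ℕ) :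
    ∀ᵐ x : Space, (fun r => min (v r) (n : ℝ≥0∞)) ‖x‖ = (fun r => min (v' r) (n : ℝ≥0∞)) ‖x‖ := by
  filter_upwards [h] with x hx
  simp only [hx]

/-- **Near-minimiser periodic BEC sees only the a.e.-class of the potential** (the hypothesis of `BoundaryTransferWeak v`).
[cite: LSSY2005, §1.2 (1.19)] -/
theorem periodicBEC_congr_ae {v v' : ℝ → ℝ≥0∞} (h : ∀ᵐ x : Space, v ‖x‖ = v' ‖x‖) :
    (∃ ρ₀ : ℝ, 0 < ρ₀ ∧ ∀ ρ : ℝ, 0 < ρ → ρ < ρ₀ → ∃ c : ℝ, 0 < c ∧ ∀ᶠ N : ℕ in atTop,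
      ∃ δ : ℝ≥0∞, 0 < δ ∧ ∀ Ψ : PeriodicTrialState N (sideLength ρ N),
        periodicEnergy v Ψ ≤ periodicGroundStateEnergy v N (sideLength ρ N) + δ →
          ENNReal.ofReal (c * N) ≤ condensateOccupation N (sideLength ρ N) Ψ.ψ) ↔
    (∃ ρ₀ : ℝ, 0 < ρ₀ ∧ ∀ ρ : ℝ, 0 < ρ → ρ < ρ₀ → ∃ c : ℝ, 0 < c ∧ ∀ᶠ N : ℕ in atTop,
      ∃ δ : ℝ≥0∞, 0 < δ ∧ ∀ Ψ : PeriodicTrialState N (sideLength ρ N),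
        periodicEnergy v' Ψ ≤ periodicGroundStateEnergy v' N (sideLength ρ N) + δ →
          ENNReal.ofReal (c * N) ≤ condensateOccupation N (sideLength ρ N) Ψ.ψ) := by
  simp only [periodicEnergy_congr_ae h, periodicGroundStateEnergy_congr_ae h]

/-- **T★ sees only the a.e.-class of the potential.** [cite: LSSY2005, §1.2 (1.19)] -/
theorem nearMinimiserTowerBEC_congr_ae :
    ∀ v v' : ℝ → ℝ≥0∞, (∀ᵐ x : Space, v ‖x‖ = v' ‖x‖) →
    ((∃ ρ₀ : ℝ, 0 < ρ₀ ∧ ∀ ρ : ℝ, 0 < ρ → ρ < ρ₀ → ∃ c : ℝ, 0 < c ∧ ∀ᶠ N : ℕ in atTop,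
        ∃ δ : ℝ≥0∞, 0 < δ ∧ ∃ n₀ : ℕ, ∀ n : ℕ, n₀ ≤ n →
          ∀ Ψ : PeriodicTrialState N (sideLength ρ N),
            periodicEnergy (fun r => min (v r) (n : ℝ≥0∞)) Ψ ≤
                periodicGroundStateEnergy (fun r => min (v r) (n : ℝ≥0∞)) N (sideLength ρ N) + δ →
              ENNReal.ofReal (c * N) ≤ condensateOccupation N (sideLength ρ N) Ψ.ψ) ↔
    (∃ ρ₀ : ℝ, 0 < ρ₀ ∧ ∀ ρ : ℝ, 0 < ρ → ρ < ρ₀ → ∃ c : ℝ, 0 < c ∧ ∀ᶠ N : ℕ in atTop,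
        ∃ δ : ℝ≥0∞, 0 < δ ∧ ∃ n₀ : ℕ, ∀ n : ℕ, n₀ ≤ n →
          ∀ Ψ : PeriodicTrialState N (sideLength ρ N),
            periodicEnergy (fun r => min (v' r) (n : ℝ≥0∞)) Ψ ≤
                periodicGroundStateEnergy (fun r => min (v' r) (n : ℝ≥0∞)) N (sideLength ρ N) + δ →
              ENNReal.ofReal (c * N) ≤ condensateOccupation N (sideLength ρ N) Ψ.ψ)) := by
  intro v v' h
  have hE : ∀ (n N : ℕ) (L : ℝ) (Ψ : PeriodicTrialState N L),
      periodicEnergy (fun r => min (v r) (n : ℝ≥0∞)) Ψ = periodicEnergy (fun r => min (v' r) (n : ℝ≥0∞)) Ψ :=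
    fun n N L Ψ => periodicEnergy_congr_ae (ae_min_congr h n) Ψ
  have hG : ∀ (n N : ℕ) (L : ℝ), periodicGroundStateEnergy (fun r => min (v r) (n : ℝ≥0∞)) N L =
      periodicGroundStateEnergy (fun r => min (v' r) (n : ℝ≥0∞)) N L :=
    fun n N L => periodicGroundStateEnergy_congr_ae (ae_min_congr h n) N L
  simp only [hE, hG]

/-- **T★ asks nothing new of ESSENTIALLY bounded potentials**: if `v` agrees a.e. (as `x ↦ v(|x|)`) with a potential bounded
by a natural number, then T★(v) ⟺ near-minimiser periodic BEC of `v`. [cite: LSSY2005, §1.2 (1.19)] -/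
theorem nearMinimiserTowerBEC_iff_periodicBEC_of_ae_bounded {v v' : ℝ → ℝ≥0∞} (h : ∀ᵐ x : Space, v ‖x‖ = v' ‖x‖)
    {M : ℕ} (hM : ∀ r, v' r ≤ M) :
    (∃ ρ₀ : ℝ, 0 < ρ₀ ∧ ∀ ρ : ℝ, 0 < ρ → ρ < ρ₀ → ∃ c : ℝ, 0 < c ∧ ∀ᶠ N : ℕ in atTop,
        ∃ δ : ℝ≥0∞, 0 < δ ∧ ∃ n₀ : ℕ, ∀ n : ℕ, n₀ ≤ n →
          ∀ Ψ : PeriodicTrialState N (sideLength ρ N),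
            periodicEnergy (fun r => min (v r) (n : ℝ≥0∞)) Ψ ≤
                periodicGroundStateEnergy (fun r => min (v r) (n : ℝ≥0∞)) N (sideLength ρ N) + δ →
              ENNReal.ofReal (c * N) ≤ condensateOccupation N (sideLength ρ N) Ψ.ψ) ↔
    (∃ ρ₀ : ℝ, 0 < ρ₀ ∧ ∀ ρ : ℝ, 0 < ρ → ρ < ρ₀ → ∃ c : ℝ, 0 < c ∧ ∀ᶠ N : ℕ in atTop,
      ∃ δ : ℝ≥0∞, 0 < δ ∧ ∀ Ψ : PeriodicTrialState N (sideLength ρ N),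
        periodicEnergy v Ψ ≤ periodicGroundStateEnergy v N (sideLength ρ N) + δ →
          ENNReal.ofReal (c * N) ≤ condensateOccupation N (sideLength ρ N) Ψ.ψ) := by
  rw [nearMinimiserTowerBEC_congr_ae v v' h, nearMinimiserTowerBEC_iff_of_bounded v' hM, periodicBEC_congr_ae h]

end Summit.AtomisticToContinuum.BoseEinsteinCondensation.Cruxes.HardCoreExtension.NearMinTower

end
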